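import Mathlib
import Literature.NumberTheory.LFunctions.Zhang2022.ToolkitGaussUnsmoothingShiu
import Literature.NumberTheory.LFunctions.Zhang2022.Section15CCalU1REuler
import Literature.NumberTheory.LFunctions.Zhang2022.Section15CU1Local
import Literature.NumberTheory.LFunctions.Zhang2022.Section15CCalM1FactorLowerBound
import Literature.NumberTheory.LFunctions.MertensFormula
import HarnessLib

/-!
# Zhang (2022), §15 p. 87, u054: "By (4.2) and (4.3), `Σ_{n<T} χ(n)τ₂(n)ϖ₁ⱼ(n)/n =
# Σ_n χ(n)τ₂(n)ϖ₁ⱼ(n) n⁻¹ g(T/n) + O(α₁)`" — the UNSMOOTHING step, kernel-checked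

Topic `Literature/NumberTheory/LFunctions/Zhang2022` (Landau–Siegel audit tree; verdict-neutral).
Y. Zhang, *Discrete mean estimates and the Landau–Siegel zero*, arXiv:2211.02515v1 (2022)
[Zhang2022LandauSiegel] — **an unrefereed manuscript under adjudication; nothing in this file asserts
or denies its Theorems 1–2.** ZHANG-L discharge lane, WP15 (leaf `h15u055RelS`, ruling R-34: the «+1»
input of `Typed.Section15C.Step15_u055RelS`) and DAG node `Z22:§15.u054` (tex L4354–L4357, typed
`Typed.Section15C.Step15_u054`, whose kernel-checked edge `step15_u054_of` reduces it to its first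
relation plus absolute convergence at `σ = 2`).

The printed justification "(4.2) and (4.3)" is pointwise; the SUMMED error is controlled by the tree's
Gaussian unsmoothing toolkit (`GaussWeight.norm_sum_Ico_sub_tsum_mul_gWeight_le_of_multiplicative`:
Shiu's Brun–Titchmarsh theorem through `Sieve.shiu_uniform`) applied to the multiplicative majorant
`f(n) = |χ(n)τ₂(n)ϖ₁ⱼ(n)|` which is TIGHT AT PRIMES: `f(q) ≤ 4 + K/q` (the local data of Lemma 15.3's
proof: `ϖ₁ⱼ(q) = χ(q)F_q(1,q)/F_q(1,1) + λ₁(q)q^{βⱼ}F_q(q,1)/F_q(1,1)` with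
`‖F_q(1,q) − F_q(1,1)‖, ‖λ₁(q)F_q(q,1) − F_q(1,1)‖ ≤ K₀/q` (`Section15CVarpiPrimePow`) and
`‖F_q(1,1;1−βⱼ)‖ ≥ c₀` (`Section15CCalM1FactorLowerBound`)), `f(qˡ) ≤ A₁ˡ`, `f(n) ≤ A₂(δ)n^δ` (from
`Section15C.norm_chi_tau_varpi1_le` and the divisor bound), and `Σ_{p≤x} f(p)/p ≤ 4 log log x + C₁`
(Mertens, `Mertens.abs_primeRecipSum_sub_le`). With `X = T = e^{𝓛^{1.1}}`, `Λ = 𝓛³⁰` the error is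
`≤ C·𝓛^{3.3}/𝓛^{15} ≤ C/𝓛¹¹`. PROVED here (theorems only; no definitions, no facts):

* `norm_varpi1_prime_le` — `‖ϖ₁ⱼ(q)‖ ≤ 2 + K₀/(c₀q)` given the local lower bound `c₀`;
* `step15_u054_h1` — `∃ C, ForAllLarge, (A) → ∀ j ∈ {1,2,3},
  ‖sumLtT − sumWeighted‖ ≤ C·(𝓛¹¹)⁻¹` at `inputs15AB`;
* `step15_u054_holds` — **the typed node `Step15_u054 c′ inputs15AB` for every `c′`** (`O(α₁)`,
  `α₁ = α𝓛 = π𝓛⁻⁸`, via `step15_u054_of`).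

## References

* Y. Zhang, arXiv:2211.02515v1 (2022), §15 p. 87 (tex L4354–L4357); §4 (4.1)–(4.3); §15 p. 85.
  [cite: Zhang2022LandauSiegel, §15 p. 87]
* P. Shiu, J. reine angew. Math. 313 (1980), Theorem 1. [cite: Shiu1980, Theorem 1]
-/

noncomputable section

open Complex Real Filter Topology Finset

namespace Literature.NumberTheory.LFunctions.Zhang2022.Typed.Section15C

open Literature.NumberTheory.LFunctions.Zhang2022
open Literature.NumberTheory.LFunctions.Zhang2022.Skeleton
open Literature.NumberTheory.LFunctions.Zhang2022.Typed.Section15A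
open Literature.NumberTheory.LFunctions.Zhang2022.Typed.Section15B

/-! ## §1. The value of `ϖ₁ⱼ` at a prime -/

/-- **`ϖ₁ⱼ(q) = χ(q)·F_q(1,q)/F_q(1,1) + λ₁(q)q^{βⱼ}·F_q(q,1)/F_q(1,1)`** at `s₀ = 1 − βⱼ` (the divisor
pairs `(1,q)`, `(q,1)` of `q`; the global ratios `𝓜₁(d,l)/𝓜₁(1,1)` are local, (15.18)), whenever the
Euler product of `𝓜₁(1,1;s₀)` converges to a non-zero value. [cite: Zhang2022LandauSiegel, §15 p. 85] -/
theorem varpi1_prime_eq (c' : ℝ) {D : ℕ} [NeZero D] (χ : DirichletCharacter ℂ D) (j : ℕ) {q : ℕ}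
    (hq : q.Prime) (hre : (1 - betaJ c' D j).re = 1)
    (hmul : Multipliable fun p : Nat.Primes => calM1Factor c' χ (p : ℕ) 1 1 (1 - betaJ c' D j))
    (hne : calM1 c' χ 1 1 (1 - betaJ c' D j) ≠ 0) :
    varpi1 c' χ j q =
      χ (q : ZMod D) * (calM1Factor c' χ q 1 q (1 - betaJ c' D j) /
          calM1Factor c' χ q 1 1 (1 - betaJ c' D j)) +
        lam1 c' χ q 1 * (q : ℂ) ^ betaJ c' D j *
          (calM1Factor c' χ q q 1 (1 - betaJ c' D j) / calM1Factor c' χ q 1 1 (1 - betaJ c' D j)) := by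
  have hs : 0 < (1 - betaJ c' D j).re := by rw [hre]; norm_num
  have h := Lemma153Rp.varpi1_prime_pow_eq_sum_range c' χ hq j 1
  rw [pow_one] at h
  rw [h, Finset.sum_range_succ, Finset.sum_range_succ, Finset.sum_range_zero, zero_add]
  have h01 := Lemma153Rp.calM1_prime_pow_div_eq c' χ hq hs hmul hne 0 1
  have h10 := Lemma153Rp.calM1_prime_pow_div_eq c' χ hq hs hmul hne 1 0
  simp only [Nat.min_self, zero_le, Nat.min_eq_left, pow_zero, pow_one, Nat.sub_zero,
    Nat.sub_self] at h01 h10 ⊢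
  rw [h01, h10, Lemma153Rp.lam1_one, Nat.cast_one, Complex.one_cpow, Nat.cast_one, map_one]
  ring

/-- **The size of `ϖ₁ⱼ` at a prime**: with `c₀ ≤ ‖F_q(1,1;1−βⱼ)‖` (`c₀ > 0`),
`‖ϖ₁ⱼ(q)‖ ≤ 2 + K₀/(c₀q)`, `K₀ = 90Z₂ + 72 + 45W²` the constants of `Section15CVarpiPrimePow`.
[cite: Zhang2022LandauSiegel, §15 p. 85; App. A p. 105] -/
theorem norm_varpi1_prime_le (c' : ℝ) {D : ℕ} [NeZero D] (χ : DirichletCharacter ℂ D) (j : ℕ)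
    {q : ℕ} (hq : q.Prime) (hre : (1 - betaJ c' D j).re = 1)
    (hmul : Multipliable fun p : Nat.Primes => calM1Factor c' χ (p : ℕ) 1 1 (1 - betaJ c' D j))
    (hne : calM1 c' χ 1 1 (1 - betaJ c' D j) ≠ 0) {c₀ : ℝ} (hc₀ : 0 < c₀)
    (hlow : c₀ ≤ ‖calM1Factor c' χ q 1 1 (1 - betaJ c' D j)‖) :
    ‖varpi1 c' χ j q‖ ≤ 2 +
      (90 * (∑' m : ℕ, ((m : ℝ) + 1) ^ 2 * (1 / 2 : ℝ) ^ m) +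
        (72 + 45 * (∑' m : ℕ, ((m : ℝ) + 2) ^ 2 * (1 / 2 : ℝ) ^ m) ^ 2)) / (c₀ * q) := by
  set Z₂ : ℝ := ∑' m : ℕ, ((m : ℝ) + 1) ^ 2 * (1 / 2 : ℝ) ^ m with hZ₂
  set W : ℝ := ∑' m : ℕ, ((m : ℝ) + 2) ^ 2 * (1 / 2 : ℝ) ^ m with hW
  set s₀ : ℂ := 1 - betaJ c' D j with hs₀
  set F11 : ℂ := calM1Factor c' χ q 1 1 s₀ with hF11
  have hq0 : (0 : ℝ) < q := by exact_mod_cast hq.pos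
  have hF0 : 0 < ‖F11‖ := lt_of_lt_of_le hc₀ hlow
  have hA := Lemma153Rp.norm_calM1Factor_one_prime_sub_le c' χ hq (s := s₀) hre
  have hB := Lemma153Rp.norm_lam_mul_calM1Factor_prime_one_sub_le c' χ hq (s := s₀) hre
  -- the two ratios
  have hQ : ‖calM1Factor c' χ q 1 q s₀ / F11‖ ≤ 1 + 90 * Z₂ / (c₀ * q) := by
    rw [norm_div, div_le_iff₀ hF0]
    calc ‖calM1Factor c' χ q 1 q s₀‖ = ‖(calM1Factor c' χ q 1 q s₀ - F11) + F11‖ := by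
          rw [sub_add_cancel]
      _ ≤ ‖calM1Factor c' χ q 1 q s₀ - F11‖ + ‖F11‖ := norm_add_le _ _
      _ ≤ 90 * Z₂ / q + ‖F11‖ := add_le_add hA le_rfl
      _ ≤ (1 + 90 * Z₂ / (c₀ * q)) * ‖F11‖ := by
          rw [add_mul, one_mul, add_comm]
          refine add_le_add le_rfl ?_
          have hZ0 : 0 ≤ Z₂ := tsum_nonneg fun m => by positivity
          calc 90 * Z₂ / q = 90 * Z₂ / (c₀ * q) * c₀ := by field_simp
            _ ≤ 90 * Z₂ / (c₀ * q) * ‖F11‖ :=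
                mul_le_mul_of_nonneg_left hlow (by positivity)
  have hR : ‖lam1 c' χ q 1 * (q : ℂ) ^ betaJ c' D j * (calM1Factor c' χ q q 1 s₀ / F11)‖ ≤
      1 + (72 + 45 * W ^ 2) / (c₀ * q) := by
    have e : lam1 c' χ q 1 * (q : ℂ) ^ betaJ c' D j * (calM1Factor c' χ q q 1 s₀ / F11) =
        (q : ℂ) ^ betaJ c' D j * ((lam1 c' χ q 1 * calM1Factor c' χ q q 1 s₀) / F11) := by
      field_simp
    rw [e, norm_mul, Lemma153Rp.norm_cpow_betaJ c' hq j, one_mul, norm_div, div_le_iff₀ hF0]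
    calc ‖lam1 c' χ q 1 * calM1Factor c' χ q q 1 s₀‖
        = ‖(lam1 c' χ q 1 * calM1Factor c' χ q q 1 s₀ - F11) + F11‖ := by rw [sub_add_cancel]
      _ ≤ ‖lam1 c' χ q 1 * calM1Factor c' χ q q 1 s₀ - F11‖ + ‖F11‖ := norm_add_le _ _
      _ ≤ (72 + 45 * W ^ 2) / q + ‖F11‖ := add_le_add hB le_rfl
      _ ≤ (1 + (72 + 45 * W ^ 2) / (c₀ * q)) * ‖F11‖ := by
          rw [add_mul, one_mul, add_comm]
          refine add_le_add le_rfl ?_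
          calc (72 + 45 * W ^ 2) / q = (72 + 45 * W ^ 2) / (c₀ * q) * c₀ := by field_simp
            _ ≤ (72 + 45 * W ^ 2) / (c₀ * q) * ‖F11‖ :=
                mul_le_mul_of_nonneg_left hlow (by positivity)
  rw [varpi1_prime_eq c' χ j hq hre hmul hne]
  calc _ ≤ ‖χ (q : ZMod D) * (calM1Factor c' χ q 1 q s₀ / F11)‖ +
        ‖lam1 c' χ q 1 * (q : ℂ) ^ betaJ c' D j * (calM1Factor c' χ q q 1 s₀ / F11)‖ :=
        norm_add_le _ _
    _ ≤ (1 + 90 * Z₂ / (c₀ * q)) + (1 + (72 + 45 * W ^ 2) / (c₀ * q)) := by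
        refine add_le_add ?_ hR
        rw [norm_mul]
        calc ‖χ (q : ZMod D)‖ * ‖calM1Factor c' χ q 1 q s₀ / F11‖
            ≤ 1 * (1 + 90 * Z₂ / (c₀ * q)) :=
              mul_le_mul (χ.norm_le_one _) hQ (norm_nonneg _) zero_le_one
          _ = 1 + 90 * Z₂ / (c₀ * q) := one_mul _
    _ = 2 + (90 * Z₂ + (72 + 45 * W ^ 2)) / (c₀ * q) := by
        field_simp
        ring

/-! ## §2. The coefficients `c(n) = χ(n)τ₂(n)ϖ₁ⱼ(n)`: multiplicativity, prime powers -/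

/-- `c(mn) = c(m)c(n)` for coprime `m, n` once `ϖ₁ⱼ` is multiplicative (§15 p. 85; `χ` and `τ₂`
are multiplicative). [cite: Zhang2022LandauSiegel, §15 p. 85] -/
theorem coeff_mul_of_coprime (c' : ℝ) {D : ℕ} [NeZero D] (χ : DirichletCharacter ℂ D) (j : ℕ)
    (hmult : ∀ m n : ℕ, Nat.Coprime m n → varpi1 c' χ j (m * n) = varpi1 c' χ j m * varpi1 c' χ j n)
    {m n : ℕ} (hmn : Nat.Coprime m n) :
    χ (((m * n : ℕ)) : ZMod D) * (((m * n).divisors.card : ℕ) : ℂ) * varpi1 c' χ j (m * n) =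
      (χ (m : ZMod D) * ((m.divisors.card : ℕ) : ℂ) * varpi1 c' χ j m) *
        (χ (n : ZMod D) * ((n.divisors.card : ℕ) : ℂ) * varpi1 c' χ j n) := by
  rw [Nat.cast_mul, map_mul, Nat.Coprime.card_divisors_mul hmn, Nat.cast_mul, hmult m n hmn]
  ring

/-- `(l+1)^t ≤ (2^t)^l` for `t ≥ 0` (`l + 1 ≤ 2ˡ`). [folklore] -/
private theorem succ_rpow_le_two_rpow_pow (l : ℕ) {t : ℝ} (ht : 0 ≤ t) :
    ((l : ℝ) + 1) ^ t ≤ ((2 : ℝ) ^ t) ^ l := by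
  have h1 : (l : ℝ) + 1 ≤ (2 : ℝ) ^ l := by
    have h := Nat.lt_two_pow_self (n := l)
    have h' : l + 1 ≤ 2 ^ l := h
    exact_mod_cast h'
  calc ((l : ℝ) + 1) ^ t ≤ ((2 : ℝ) ^ l) ^ t := Real.rpow_le_rpow (by positivity) h1 ht
    _ = ((2 : ℝ) ^ t) ^ l := by
        rw [← Real.rpow_natCast, ← Real.rpow_mul (by norm_num), mul_comm, Real.rpow_mul (by norm_num),
          Real.rpow_natCast]

/-! ## §3. Thresholds in `D` -/

/-- `log D ≥ M` once `D ≥ ⌈e^M⌉`. [folklore] -/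
private theorem le_ell_of_ceil_exp_le₈ {M : ℝ} {D : ℕ} (hD : ⌈Real.exp M⌉₊ ≤ D) : M ≤ ell D := by
  have h : Real.exp M ≤ D := le_trans (Nat.le_ceil _) (by exact_mod_cast hD)
  exact (Real.le_log_iff_exp_le (lt_of_lt_of_le (Real.exp_pos _) h)).mpr h

/-- For all large `D`: `X₀ ≤ T`, `4 ≤ 𝓛³⁰`, `4 ≤ 2𝓛³⁰`, `e²𝓛³⁰ ≤ T` and `1 ≤ 𝓛`
(`T = e^{𝓛^{1.1}}`, `𝓛 = log D`). [cite: Zhang2022LandauSiegel, §2 (2.1), §6 p. 31] -/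
private theorem eventually_thresholds (X₀ : ℝ) :
    ∃ N : ℕ, ∀ D : ℕ, N ≤ D → X₀ ≤ bigT D ∧ (4 : ℝ) ≤ ell D ^ 30 ∧ ((3 : ℕ) : ℝ) + 1 ≤ 2 * ell D ^ 30 ∧
      Real.exp 2 * ell D ^ 30 ≤ bigT D ∧ 1 ≤ ell D := by
  have hℓ : Tendsto (fun D : ℕ => ell D) atTop atTop :=
    Real.tendsto_log_atTop.comp tendsto_natCast_atTop_atTop
  -- `log 𝓛 ≤ 𝓛/60` eventually
  have h1 : Tendsto (fun x : ℝ => Real.log x ^ 1 / (1 * x + 0)) atTop (𝓝 0) :=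
    Real.tendsto_pow_log_div_mul_add_atTop 1 0 1 one_ne_zero
  have h2 : ∀ᶠ D : ℕ in atTop, Real.log (ell D) ^ 1 / (1 * ell D + 0) ≤ 1 / 60 :=
    (h1.comp hℓ).eventually (eventually_le_nhds (by norm_num))
  have h3 : ∀ᶠ D : ℕ in atTop, max 4 (Real.log (max X₀ 1)) ≤ ell D :=
    hℓ.eventually (eventually_ge_atTop _)
  obtain ⟨N, hN⟩ := Filter.eventually_atTop.mp (h2.and h3)
  refine ⟨N, fun D hD => ?_⟩
  obtain ⟨ha, hb⟩ := hN D hD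
  have hℓ4 : 4 ≤ ell D := (le_max_left _ _).trans hb
  have hℓX : Real.log (max X₀ 1) ≤ ell D := (le_max_right _ _).trans hb
  have hℓ1 : 1 ≤ ell D := by linarith
  have hℓ0 : 0 < ell D := by linarith
  rw [pow_one, one_mul, add_zero, div_le_iff₀ hℓ0] at ha
  -- `𝓛 ≤ 𝓛^{1.1}`
  have hpow : ell D ≤ ell D ^ (1.1 : ℝ) := by
    calc ell D = ell D ^ (1 : ℝ) := (Real.rpow_one _).symm
      _ ≤ ell D ^ (1.1 : ℝ) := Real.rpow_le_rpow_of_exponent_le hℓ1 (by norm_num)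
  have hℓ30 : (4 : ℝ) ≤ ell D ^ 30 := by
    calc (4 : ℝ) ≤ ell D := hℓ4
      _ = ell D ^ 1 := (pow_one _).symm
      _ ≤ ell D ^ 30 := pow_le_pow_right₀ hℓ1 (by norm_num)
  refine ⟨?_, hℓ30, ?_, ?_, hℓ1⟩
  · -- `X₀ ≤ max X₀ 1 = exp(log(max X₀ 1)) ≤ exp 𝓛 ≤ exp(𝓛^{1.1}) = T`
    have hm : 0 < max X₀ 1 := lt_of_lt_of_le one_pos (le_max_right _ _)
    calc X₀ ≤ max X₀ 1 := le_max_left _ _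
      _ = Real.exp (Real.log (max X₀ 1)) := (Real.exp_log hm).symm
      _ ≤ Real.exp (ell D ^ (1.1 : ℝ)) := Real.exp_le_exp.mpr (hℓX.trans hpow)
      _ = bigT D := rfl
  · push_cast; linarith
  · -- `2 + 30 log 𝓛 ≤ 𝓛/2 + 𝓛/2 = 𝓛 ≤ 𝓛^{1.1}`
    rw [bigT, ← Real.exp_log (by positivity : 0 < ell D ^ 30), ← Real.exp_add, Real.exp_le_exp,
      Real.log_pow]
    push_cast
    nlinarith

/-! ## §4. Prime sums: Mertens and `Σ 1/p²` -/

/-- The primes in `[1, n]`. [folklore] -/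
private theorem filter_prime_Icc_eq_primesLE (n : ℕ) :
    (Finset.Icc 1 n).filter Nat.Prime = Nat.primesLE n := by
  ext p
  simp only [Finset.mem_filter, Finset.mem_Icc, Nat.mem_primesLE]
  exact ⟨fun h => ⟨h.1.2, h.2⟩, fun h => ⟨⟨h.2.one_lt.le, h.1⟩, h.2⟩⟩

/-- **Mertens, upper form**: `Σ_{p≤x} 1/p ≤ log log x + (|B₁| + 8)` for `x ≥ 3` (tree
`Mertens.abs_primeRecipSum_sub_le`). [cite: HardyWright2008, Thm 427] -/
private theorem sum_primes_inv_le {x : ℝ} (hx : 3 ≤ x) :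
    ∑ p ∈ (Finset.Icc 1 ⌊x⌋₊).filter Nat.Prime, (1 : ℝ) / p ≤
      Real.log (Real.log x) + (|Mertens.meisselMertens| + 8) := by
  have h := abs_le.mp (Mertens.abs_primeRecipSum_sub_le (x := x) (by linarith))
  have hlog : 1 < Real.log x := by
    rw [Real.lt_log_iff_exp_lt (by linarith)]
    have := Real.exp_one_lt_d9; linarith
  have h8 : 8 / Real.log x ≤ 8 := by
    rw [div_le_iff₀ (by linarith)]; nlinarith
  have hP : Mertens.primeRecipSum x = ∑ p ∈ (Finset.Icc 1 ⌊x⌋₊).filter Nat.Prime, (1 : ℝ) / p := by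
    rw [Mertens.primeRecipSum, filter_prime_Icc_eq_primesLE]
    exact Finset.sum_congr rfl fun p _ => (one_div _).symm
  rw [← hP]
  have := le_abs_self Mertens.meisselMertens
  linarith [h.2]

/-- `Σ_{p≤n prime} 1/p² ≤ π²/6`. [folklore] -/
private theorem sum_primes_inv_sq_le (n : ℕ) :
    ∑ p ∈ (Finset.Icc 1 n).filter Nat.Prime, (1 : ℝ) / (p : ℝ) ^ 2 ≤ π ^ 2 / 6 := by
  calc ∑ p ∈ (Finset.Icc 1 n).filter Nat.Prime, (1 : ℝ) / (p : ℝ) ^ 2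
      ≤ ∑' p : ℕ, (1 : ℝ) / (p : ℝ) ^ 2 :=
        hasSum_zeta_two.summable.sum_le_tsum _ (fun p _ => by positivity)
    _ = π ^ 2 / 6 := hasSum_zeta_two.tsum_eq

/-! ## §5. The unsmoothing step u054 -/

/-- **Z22:§15.u054, first relation, with the rate `O(𝓛⁻¹¹)`**: for all large `D`, under (A), for
`1 ≤ j ≤ 3`, `‖Σ_{n<T} χ(n)τ₂(n)ϖ₁ⱼ(n)/n − Σ_n χ(n)τ₂(n)ϖ₁ⱼ(n)n⁻¹g(T/n)‖ ≤ C/𝓛¹¹` (at the landed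
objects `inputs15AB`): the Gaussian unsmoothing toolkit with the tight-at-primes multiplicative
majorant `|χ(n)τ₂(n)ϖ₁ⱼ(n)|` (`f(q) ≤ 4 + K/q`, Shiu exponent `k = 3`), `X = T = e^{𝓛^{1.1}}`,
`Λ = 𝓛³⁰`: error `≤ C𝓛^{3.3}/𝓛^{15}`. Original: "By (4.2) and (4.3), `Σ_{n<T} … = Σ_n … g(T/n) + O(α₁)`"
(§15 p. 87, tex L4354–L4357). [cite: Zhang2022LandauSiegel, §15 p. 87] -/
theorem step15_u054_h1 (c' : ℝ) :
    ∃ C : ℝ, 0 ≤ C ∧ ForAllLarge fun D _ χ => AssumptionA D χ → ∀ j ∈ ({1, 2, 3} : Finset ℕ),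
      ‖sumLtT c' inputs15AB χ j - sumWeighted c' inputs15AB χ j‖ ≤ C * (ell D ^ 11)⁻¹ := by
  classical
  -- the lane's §15 facts, with their constants
  obtain ⟨c, C, h35⟩ := step15_u035_holds c'
  obtain ⟨c₀, hc₀, hlow⟩ := norm_calM1Factor_one_one_betaJ_ge c'
  have h18 := Lemma153Rp.eq15_18_at_betaJ c'
  have hM := norm_calM1_one_one_betaJ_ge c'
  have hmultAll := inline15_varpiMult_holds c'
  -- the Shiu data (uniform in `D`, `χ`, `j`)
  set t : ℝ := (2 : ℝ) + Real.logb 2 (5 * (1 + |c|)) with ht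
  have hA5 : (1 : ℝ) ≤ 5 * (1 + |c|) := by nlinarith [abs_nonneg c]
  have ht0 : 0 < t := by have := Real.logb_nonneg one_lt_two hA5; rw [ht]; linarith
  set A₁ : ℝ := (2 * |C| + 1) * (2 : ℝ) ^ t with hA₁
  have hA₁0 : 0 ≤ A₁ := by positivity
  have hdiv : ∀ δ : ℝ, ∃ C₀ : ℝ, 0 < δ →
      (1 ≤ C₀ ∧ ∀ n : ℕ, n ≠ 0 → (n.divisors.card : ℝ) ≤ C₀ * (n : ℝ) ^ (δ / t)) := by
    intro δ
    by_cases hδ : 0 < δ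
    · obtain ⟨C₀, hC₀1, hC₀⟩ :=
        Literature.NumberTheory.Sieve.exists_card_divisors_le_mul_rpow (div_pos hδ ht0)
      exact ⟨C₀, fun _ => ⟨hC₀1, hC₀⟩⟩
    · exact ⟨1, fun h => absurd h hδ⟩
  choose Cδ hCδ using hdiv
  set A₂ : ℝ → ℝ := fun δ => 2 * |C| * Cδ δ ^ t with hA₂
  set Z₂ : ℝ := ∑' m : ℕ, ((m : ℝ) + 1) ^ 2 * (1 / 2 : ℝ) ^ m with hZ₂
  set W : ℝ := ∑' m : ℕ, ((m : ℝ) + 2) ^ 2 * (1 / 2 : ℝ) ^ m with hW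
  have hZ₂0 : 0 ≤ Z₂ := tsum_nonneg fun m => by positivity
  set K₀ : ℝ := 90 * Z₂ + (72 + 45 * W ^ 2) with hK₀
  have hK₀0 : 0 ≤ K₀ := by positivity
  set K : ℝ := 2 * K₀ / c₀ with hK
  have hKnn : 0 ≤ K := by positivity
  set C₁ : ℝ := 4 * (|Mertens.meisselMertens| + 8) + K * (π ^ 2 / 6) with hC₁
  obtain ⟨Cg, X₀, hCg, hmain⟩ :=
    GaussWeight.norm_sum_Ico_sub_tsum_mul_gWeight_le_of_multiplicative hA₁0 A₂ 3 C₁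
  obtain ⟨N, hN⟩ := eventually_thresholds X₀
  have hT : ForAllLarge fun D _ _ => X₀ ≤ bigT D ∧ (4 : ℝ) ≤ ell D ^ 30 ∧
      ((3 : ℕ) : ℝ) + 1 ≤ 2 * ell D ^ 30 ∧ Real.exp 2 * ell D ^ 30 ≤ bigT D ∧ 1 ≤ ell D :=
    ForAllLarge.of_le N fun D _ _ hD _ _ => hN D hD
  refine ⟨Cg, hCg, (((((h35.and hlow).and h18).and hM).and hmultAll).and hT).mono
    fun D _ χ hq hp hS hA j hj => ?_⟩
  obtain ⟨⟨⟨⟨⟨h35D, hlowD⟩, h18D⟩, hMD⟩, hmultD⟩, ⟨hX₀T, hΛ4, hΛk, hΛX, hℓ1⟩⟩ := hS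
  have hℓ0 : 0 < ell D := by linarith
  -- pointwise facts at `(D, χ, j)`
  obtain ⟨hM0, hmul, -⟩ := h18D hA j
  obtain ⟨-, hre, -⟩ := hMD hA j hj
  have hne : calM1 c' χ 1 1 (1 - betaJ c' D j) ≠ 0 := by
    intro h0; rw [h0, norm_zero] at hM0; linarith
  have h35j : ∀ d l : ℕ, 1 ≤ d → 1 ≤ l →
      ‖calM1 c' χ d l (1 - betaJ c' D j)‖ ≤
        C * ∏ q ∈ (d * l).primeFactors, (1 + c * (q : ℝ) ^ (-(9 / 10 : ℝ))) :=
    fun d l hd hl => h35D hA d l hd hl _ (by rw [hre]; norm_num)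
  obtain ⟨-, hvmul⟩ := hmultD hA j hj
  -- the coefficients `a(n) = χ(n)τ₂(n)ϖ₁ⱼ(n)` and the majorant `f = |a|`
  set a : ℕ → ℂ := fun n => χ (n : ZMod D) * (n.divisors.card : ℂ) * inputs15AB.varpi1 c' χ j n
    with ha
  have ha' : ∀ n, a n = χ (n : ZMod D) * (n.divisors.card : ℂ) * varpi1 c' χ j n := fun n => rfl
  set f : ℕ → ℝ := fun n => ‖a n‖ with hf
  have hfmul : ∀ m n : ℕ, m.Coprime n → f (m * n) = f m * f n := by
    intro m n hmn
    simp only [hf, ha']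
    rw [coeff_mul_of_coprime c' χ j hvmul hmn, norm_mul]
  have hgen : ∀ n : ℕ, n ≠ 0 → f n ≤ 2 * |C| * (n.divisors.card : ℝ) ^ t := fun n hn => by
    simp only [hf, ha']
    exact norm_chi_tau_varpi1_le c' χ j hM0 h35j hn
  have hA₁' : ∀ p l : ℕ, p.Prime → 1 ≤ l → f (p ^ l) ≤ A₁ ^ l := by
    intro p l hpr hl
    have hpl : p ^ l ≠ 0 := pow_ne_zero _ hpr.ne_zero
    have hτ : ((p ^ l).divisors.card : ℝ) = (l : ℝ) + 1 := by
      rw [Nat.divisors_prime_pow hpr, Finset.card_map, Finset.card_range]; push_cast; ring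
    calc f (p ^ l) ≤ 2 * |C| * ((p ^ l).divisors.card : ℝ) ^ t := hgen _ hpl
      _ = 2 * |C| * ((l : ℝ) + 1) ^ t := by rw [hτ]
      _ ≤ (2 * |C| + 1) ^ l * ((2 : ℝ) ^ t) ^ l := by
          have h1 : ((l : ℝ) + 1) ^ t ≤ ((2 : ℝ) ^ t) ^ l := succ_rpow_le_two_rpow_pow l ht0.le
          have h2 : 2 * |C| ≤ (2 * |C| + 1) ^ l := by
            calc 2 * |C| ≤ 2 * |C| + 1 := by linarith
              _ = (2 * |C| + 1) ^ 1 := (pow_one _).symm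
              _ ≤ (2 * |C| + 1) ^ l := pow_le_pow_right₀ (by linarith [abs_nonneg C]) hl
          exact mul_le_mul h2 h1 (by positivity) (by positivity)
      _ = A₁ ^ l := by rw [hA₁, mul_pow]
  have hA₂' : ∀ δ : ℝ, 0 < δ → ∀ n : ℕ, 1 ≤ n → f n ≤ A₂ δ * (n : ℝ) ^ δ := by
    intro δ hδ n hn
    have hn0 : n ≠ 0 := by omega
    have hnR : (0 : ℝ) < n := by exact_mod_cast Nat.pos_of_ne_zero hn0
    obtain ⟨hC₀1, hC₀⟩ := hCδ δ hδ
    have hC₀0 : 0 ≤ Cδ δ := zero_le_one.trans hC₀1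
    have hτ : (n.divisors.card : ℝ) ≤ Cδ δ * (n : ℝ) ^ (δ / t) := hC₀ n hn0
    calc f n ≤ 2 * |C| * (n.divisors.card : ℝ) ^ t := hgen n hn0
      _ ≤ 2 * |C| * (Cδ δ * (n : ℝ) ^ (δ / t)) ^ t :=
          mul_le_mul_of_nonneg_left (Real.rpow_le_rpow (Nat.cast_nonneg _) hτ ht0.le) (by positivity)
      _ = 2 * |C| * Cδ δ ^ t * (n : ℝ) ^ δ := by
          rw [Real.mul_rpow hC₀0 (Real.rpow_nonneg hnR.le _), ← Real.rpow_mul hnR.le,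
            div_mul_cancel₀ δ ht0.ne']
          ring
      _ = A₂ δ * (n : ℝ) ^ δ := by rw [hA₂]
  -- prime values: `f(q) ≤ 4 + K/q`
  have hprime : ∀ q : ℕ, q.Prime → f q ≤ 4 + K / q := by
    intro q hqp
    have hq0 : (0 : ℝ) < q := by exact_mod_cast hqp.pos
    have hv := norm_varpi1_prime_le c' χ j hqp hre hmul hne hc₀ (hlowD hA j hj q hqp)
    have hτ : ((q.divisors.card : ℕ) : ℂ) = 2 := by
      rw [Nat.Prime.divisors hqp, Finset.card_pair hqp.one_lt.ne]; norm_num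
    simp only [hf, ha']
    rw [norm_mul, norm_mul, hτ, Complex.norm_two]
    calc ‖χ (q : ZMod D)‖ * 2 * ‖varpi1 c' χ j q‖ ≤ 1 * 2 * (2 + K₀ / (c₀ * q)) :=
          mul_le_mul (mul_le_mul_of_nonneg_right (χ.norm_le_one _) zero_le_two) hv
            (norm_nonneg _) (by norm_num)
      _ = 4 + K / q := by rw [hK]; field_simp; ring
  have hprimes : ∀ x : ℝ, 3 ≤ x →
      ∑ p ∈ (Finset.Icc 1 ⌊x⌋₊).filter Nat.Prime, f p / p ≤
        (((3 : ℕ) : ℝ) + 1) * Real.log (Real.log x) + C₁ := by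
    intro x hx
    have hterm : ∀ p ∈ (Finset.Icc 1 ⌊x⌋₊).filter Nat.Prime,
        f p / p ≤ 4 * ((1 : ℝ) / p) + K * ((1 : ℝ) / (p : ℝ) ^ 2) := by
      intro p hp
      have hpr : p.Prime := (Finset.mem_filter.mp hp).2
      have hp0 : (0 : ℝ) < p := by exact_mod_cast hpr.pos
      calc f p / p ≤ (4 + K / p) / p := div_le_div_of_nonneg_right (hprime p hpr) hp0.le
        _ = 4 * ((1 : ℝ) / p) + K * ((1 : ℝ) / (p : ℝ) ^ 2) := by field_simp
    calc ∑ p ∈ (Finset.Icc 1 ⌊x⌋₊).filter Nat.Prime, f p / p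
        ≤ ∑ p ∈ (Finset.Icc 1 ⌊x⌋₊).filter Nat.Prime,
            (4 * ((1 : ℝ) / p) + K * ((1 : ℝ) / (p : ℝ) ^ 2)) := Finset.sum_le_sum hterm
      _ = 4 * ∑ p ∈ (Finset.Icc 1 ⌊x⌋₊).filter Nat.Prime, (1 : ℝ) / p +
            K * ∑ p ∈ (Finset.Icc 1 ⌊x⌋₊).filter Nat.Prime, (1 : ℝ) / (p : ℝ) ^ 2 := by
          rw [Finset.sum_add_distrib, Finset.mul_sum, Finset.mul_sum]
      _ ≤ 4 * (Real.log (Real.log x) + (|Mertens.meisselMertens| + 8)) + K * (π ^ 2 / 6) :=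
          add_le_add (mul_le_mul_of_nonneg_left (sum_primes_inv_le hx) (by norm_num))
            (mul_le_mul_of_nonneg_left (sum_primes_inv_sq_le _) hKnn)
      _ = (((3 : ℕ) : ℝ) + 1) * Real.log (Real.log x) + C₁ := by rw [hC₁]; push_cast; ring
  -- the toolkit
  obtain ⟨-, hbound⟩ := hmain f (fun n => norm_nonneg _) hfmul hA₁' hA₂' hprimes a
    (fun n _ => le_rfl) (bigT D) (ell D ^ 30) hX₀T hΛ4 hΛk hΛX
  have hL : sumLtT c' inputs15AB χ j = ∑ n ∈ Finset.Ico 1 ⌈bigT D⌉₊, a n / n := rfl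
  have hWt : sumWeighted c' inputs15AB χ j =
      ∑' n : ℕ, a n / n * (GaussWeight.gWeight (ell D ^ 30) (bigT D / n) : ℂ) := rfl
  rw [hL, hWt]
  refine hbound.trans ?_
  -- `Cg·(𝓛^{1.1})³/√(𝓛³⁰) ≤ Cg/𝓛¹¹`
  have hlogT : Real.log (bigT D) = ell D ^ (1.1 : ℝ) := by rw [bigT, Real.log_exp]
  have hsqrt : Real.sqrt (ell D ^ 30) = ell D ^ 15 := by
    rw [show ell D ^ 30 = (ell D ^ 15) ^ 2 by ring, Real.sqrt_sq (by positivity)]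
  rw [hlogT, hsqrt]
  have h33 : (ell D ^ (1.1 : ℝ)) ^ 3 ≤ ell D ^ 4 := by
    calc (ell D ^ (1.1 : ℝ)) ^ 3 = ell D ^ ((1.1 : ℝ) * 3) := by
          rw [← Real.rpow_natCast (ell D ^ (1.1 : ℝ)) 3, ← Real.rpow_mul hℓ0.le]; norm_num
      _ ≤ ell D ^ (4 : ℝ) := Real.rpow_le_rpow_of_exponent_le hℓ1 (by norm_num)
      _ = ell D ^ 4 := by norm_cast
  calc Cg * (ell D ^ (1.1 : ℝ)) ^ 3 / ell D ^ 15 ≤ Cg * ell D ^ 4 / ell D ^ 15 := by gcongr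
    _ = Cg * (ell D ^ 11)⁻¹ := by field_simp

/-- **Z22:§15.u054 HOLDS** (the typed node `Typed.Section15C.Step15_u054 c′ inputs15AB`, printed rate
`O(α₁)`, `α₁ = α𝓛 = π𝓛⁻⁸`): both relations "Σ_{n<T} = Σ_n … g(T/n) + O(α₁) = (2πi)⁻¹∫_{(1)} … + O(α₁)"
— the first by `step15_u054_h1` (`C/𝓛¹¹ ≤ (C/π)·α𝓛`), the second by the exact Mellin identity
(`step15_u054_of`, absolute convergence at `σ = 2` from `lseriesSummable_chi_tau_varpi1`).
[cite: Zhang2022LandauSiegel, §15 p. 87] -/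
theorem step15_u054_holds (c' : ℝ) : Step15_u054 c' inputs15AB := by
  obtain ⟨C, hC0, h1⟩ := step15_u054_h1 c'
  obtain ⟨c, C₃₅, h35⟩ := step15_u035_holds c'
  have hM := norm_calM1_one_one_betaJ_ge c'
  refine step15_u054_of c' inputs15AB ⟨C / π, ?_⟩ ((h35.and hM).mono fun D _ χ _ _ hS hA j hj => ?_)
  have hℓ : ForAllLarge fun D _ _ => (1 : ℝ) ≤ ell D :=
    ForAllLarge.of_le ⌈Real.exp 1⌉₊ fun D _ _ hD _ _ => le_ell_of_ceil_exp_le₈ hD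
  · refine (h1.and hℓ).mono fun D _ χ _ _ hS hA j hj => ?_
    obtain ⟨h1D, hℓ1⟩ := hS
    have hℓ0 : 0 < ell D := by linarith
    have hα : alpha D = π / ell D ^ 9 := by rw [alpha, bigP, Real.log_exp]
    refine (h1D hA j hj).trans ?_
    rw [hα]
    have h8 : ell D ^ 8 ≤ ell D ^ 11 := pow_le_pow_right₀ hℓ1 (by norm_num)
    calc C * (ell D ^ 11)⁻¹ ≤ C * (ell D ^ 8)⁻¹ := by
          gcongr
      _ = C / π * (π / ell D ^ 9 * ell D) := by field_simp
  · obtain ⟨h35D, hMD⟩ := hS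
    obtain ⟨-, hre, hM0⟩ := hMD hA j hj
    have h35j : ∀ d l : ℕ, 1 ≤ d → 1 ≤ l →
        ‖calM1 c' χ d l (1 - betaJ c' D j)‖ ≤
          C₃₅ * ∏ q ∈ (d * l).primeFactors, (1 + c * (q : ℝ) ^ (-(9 / 10 : ℝ))) :=
      fun d l hd hl => h35D hA d l hd hl _ (by rw [hre]; norm_num)
    exact lseriesSummable_chi_tau_varpi1 c' χ j hM0 h35j (by norm_num)

end Literature.NumberTheory.LFunctions.Zhang2022.Typed.Section15C

end
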